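import Mathlib

/-!
# `SnSubsetDichotomy.HyperoctahedralThreshold`, line `refutation-local-symmetry` — stub `stub_manySimpleTwins`

Two disjoint clean closed walks out of many (crux `stmt-MatrixMultiplication-10883`, registered stub
`stub_manySimpleTwins` of the lead's skeleton for line `refutation-local-symmetry`).

Setting: `μ 0, μ 1, μ 2` are permutations of `Fin n`, `col : Fin (k+2) → Fin 3` is a cyclic colour
word, and a *closed walk reading `col`* is a `p : Fin (k+2) → Fin n` with `μ (col i) (p i) = p (i+1)`
for every `i : Fin (k+2)` (indices wrap around).  Claim: a finite set `P` of closed walks reading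
`col` with more than `(k+2)|R| + (k+2)²` elements contains two walks `p, q` with disjoint point sets,
both avoiding the forbidden set `R ⊆ Fin n`.

Proof (pure counting).
* Determinism (`ManySimpleTwins.walk_ext`): two closed walks reading `col` that agree at one index
  agree at every index (induction along the cycle, `p (i+1) = μ (col i) (p i)`).  Hence for each
  index `i` the evaluation `p ↦ p i` is injective on `P`.
* So at most `|R|` walks of `P` pass through `R` at a given index
  (`ManySimpleTwins.card_filter_mem_le`), and the set `H` of walks of `P` meeting `R` has
  `|H| ≤ (k+2)|R| < |P|` (`ManySimpleTwins.card_meet_le`).  Pick `p ∈ P \ H`.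
* The set `C` of walks `q ∈ P` sharing a point with `p` (`p i = q j` for some `i, j`) has
  `|C| ≤ (k+2)²`, since for each pair `(i, j)` at most one `q ∈ P` has `q j = p i`
  (`ManySimpleTwins.card_touch_le`).
* `|H ∪ C| ≤ (k+2)|R| + (k+2)² < |P|`, so some `q ∈ P` lies outside `H ∪ C`; the pair `(p, q)`
  works.
(The hypothesis that the walks in `P` are injective is not used.)
-/

-- the tree's namespace `Summit.MatrixMultiplication.MatrixMultiplication.…` repeats a component by design
set_option linter.dupNamespace false

namespace Summit.MatrixMultiplication.MatrixMultiplication.Theorems.HyperoctahedralThreshold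

namespace ManySimpleTwins

/-- Determinism of closed walks: two closed walks reading the same cyclic colour word that agree at
one index agree everywhere. [folklore] -/
theorem walk_ext {n k : ℕ} (μ : Fin 3 → Equiv.Perm (Fin n)) (col : Fin (k + 2) → Fin 3)
    {p q : Fin (k + 2) → Fin n} (hp : ∀ i, μ (col i) (p i) = p (i + 1))
    (hq : ∀ i, μ (col i) (q i) = q (i + 1)) {j : Fin (k + 2)} (h : p j = q j) : p = q := by
  -- walk forward from `j`: `p (j + d) = q (j + d)` for every `d`, by induction on `d`
  have key : ∀ d : Fin (k + 2), p (j + d) = q (j + d) := by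
    intro d
    induction d using Fin.induction with
    | zero => simpa using h
    | succ d ih =>
      have e : j + d.succ = j + d.castSucc + 1 := by
        rw [← Fin.coeSucc_eq_succ]
        exact (add_assoc j _ _).symm
      rw [e, ← hp, ← hq, ih]
  funext i
  have := key (i - j)
  rwa [add_sub_cancel j i] at this

/-- At a fixed index `i`, at most `|R|` closed walks of `P` pass through `R` (the evaluation
`p ↦ p i` is injective on closed walks reading one word). [folklore] -/
theorem card_filter_mem_le {n k : ℕ} (μ : Fin 3 → Equiv.Perm (Fin n)) (col : Fin (k + 2) → Fin 3)
    (R : Finset (Fin n)) (P : Finset (Fin (k + 2) → Fin n))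
    (hP : ∀ p ∈ P, ∀ i, μ (col i) (p i) = p (i + 1)) (i : Fin (k + 2)) :
    (P.filter fun p => p i ∈ R).card ≤ R.card := by
  refine Finset.card_le_card_of_injOn (fun p => p i) ?_ ?_
  · intro p hp
    exact (Finset.mem_filter.1 (Finset.mem_coe.1 hp)).2
  · intro p hp q hq hpq
    exact walk_ext μ col (hP p (Finset.mem_filter.1 (Finset.mem_coe.1 hp)).1)
      (hP q (Finset.mem_filter.1 (Finset.mem_coe.1 hq)).1) hpq

/-- The closed walks of `P` meeting `R` number at most `(k+2)|R|`. [folklore] -/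
theorem card_meet_le {n k : ℕ} (μ : Fin 3 → Equiv.Perm (Fin n)) (col : Fin (k + 2) → Fin 3)
    (R : Finset (Fin n)) (P : Finset (Fin (k + 2) → Fin n))
    (hP : ∀ p ∈ P, ∀ i, μ (col i) (p i) = p (i + 1)) :
    (P.filter fun p => ∃ i, p i ∈ R).card ≤ (k + 2) * R.card := by
  calc (P.filter fun p => ∃ i, p i ∈ R).card
      ≤ (Finset.univ.biUnion fun i : Fin (k + 2) => P.filter fun p => p i ∈ R).card := by
        refine Finset.card_le_card fun p hp => ?_
        obtain ⟨hpP, i, hi⟩ := Finset.mem_filter.1 hp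
        exact Finset.mem_biUnion.2 ⟨i, Finset.mem_univ i, Finset.mem_filter.2 ⟨hpP, hi⟩⟩
    _ ≤ ∑ i : Fin (k + 2), (P.filter fun p => p i ∈ R).card := Finset.card_biUnion_le
    _ ≤ ∑ _i : Fin (k + 2), R.card :=
        Finset.sum_le_sum fun i _ => card_filter_mem_le μ col R P hP i
    _ = (k + 2) * R.card := by simp

/-- A fixed closed walk `p` shares a point with at most `(k+2)²` closed walks of `P`: for each pair
of indices `(i, j)` at most one `q ∈ P` has `q j = p i`. [folklore] -/
theorem card_touch_le {n k : ℕ} (μ : Fin 3 → Equiv.Perm (Fin n)) (col : Fin (k + 2) → Fin 3)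
    (P : Finset (Fin (k + 2) → Fin n)) (hP : ∀ p ∈ P, ∀ i, μ (col i) (p i) = p (i + 1))
    (p : Fin (k + 2) → Fin n) :
    (P.filter fun q => ∃ i j, p i = q j).card ≤ (k + 2) ^ 2 := by
  calc (P.filter fun q => ∃ i j, p i = q j).card
      ≤ (Finset.univ.biUnion fun i : Fin (k + 2) =>
          Finset.univ.biUnion fun j : Fin (k + 2) => P.filter fun q => p i = q j).card := by
        refine Finset.card_le_card fun q hq => ?_
        obtain ⟨hqP, i, j, hij⟩ := Finset.mem_filter.1 hq
        exact Finset.mem_biUnion.2 ⟨i, Finset.mem_univ i,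
          Finset.mem_biUnion.2 ⟨j, Finset.mem_univ j, Finset.mem_filter.2 ⟨hqP, hij⟩⟩⟩
    _ ≤ ∑ i : Fin (k + 2),
          (Finset.univ.biUnion fun j : Fin (k + 2) => P.filter fun q => p i = q j).card :=
        Finset.card_biUnion_le
    _ ≤ ∑ i : Fin (k + 2), ∑ j : Fin (k + 2), (P.filter fun q => p i = q j).card :=
        Finset.sum_le_sum fun i _ => Finset.card_biUnion_le
    _ ≤ ∑ _i : Fin (k + 2), ∑ _j : Fin (k + 2), 1 := by
        refine Finset.sum_le_sum fun i _ => Finset.sum_le_sum fun j _ => ?_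
        refine Finset.card_le_one.2 fun q hq q' hq' => ?_
        obtain ⟨hqP, hqi⟩ := Finset.mem_filter.1 hq
        obtain ⟨hq'P, hq'i⟩ := Finset.mem_filter.1 hq'
        exact walk_ext μ col (hP q hqP) (hP q' hq'P) (hqi.symm.trans hq'i)
    _ = (k + 2) ^ 2 := by simp [sq]

end ManySimpleTwins

/-- **Two disjoint clean closed walks** (stub `stub_manySimpleTwins` of line
`refutation-local-symmetry`): among more than `(k+2)|R| + (k+2)²` closed walks reading one cyclic
colour word of length `k+2` there are two with disjoint point sets, both avoiding `R`.
[folklore] -/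
theorem stub_manySimpleTwins : ∀ (n k : ℕ) (μ : Fin 3 → Equiv.Perm (Fin n)) (col : Fin (k + 2) → Fin 3) (R : Finset (Fin n)) (P : Finset (Fin (k + 2) → Fin n)), (∀ p ∈ P, Function.Injective p ∧ ∀ i, μ (col i) (p i) = p (i + 1)) → (k + 2) * R.card + (k + 2) ^ 2 < P.card → ∃ p ∈ P, ∃ q ∈ P, (∀ i j, p i ≠ q j) ∧ (∀ i, p i ∉ R ∧ q i ∉ R) := by
  intro n k μ col R P hP hcard
  have hP' : ∀ p ∈ P, ∀ i, μ (col i) (p i) = p (i + 1) := fun p hp => (hP p hp).2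
  have hH := ManySimpleTwins.card_meet_le μ col R P hP'
  -- a closed walk `p ∈ P` avoiding `R`
  obtain ⟨p, hpP, hpH⟩ := Finset.exists_mem_notMem_of_card_lt_card
    (s := P.filter fun p => ∃ i, p i ∈ R) (t := P) (by omega)
  have hC := ManySimpleTwins.card_touch_le μ col P hP' p
  -- a closed walk `q ∈ P` avoiding `R` and the points of `p`
  obtain ⟨q, hqP, hqU⟩ := Finset.exists_mem_notMem_of_card_lt_card
    (s := (P.filter fun p => ∃ i, p i ∈ R) ∪ P.filter fun q => ∃ i j, p i = q j) (t := P)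
    ((Finset.card_union_le _ _).trans_lt (by omega))
  rw [Finset.mem_union, not_or] at hqU
  exact ⟨p, hpP, q, hqP, fun i j hij => hqU.2 (Finset.mem_filter.2 ⟨hqP, i, j, hij⟩),
    fun i => ⟨fun hi => hpH (Finset.mem_filter.2 ⟨hpP, i, hi⟩),
      fun hi => hqU.1 (Finset.mem_filter.2 ⟨hqP, i, hi⟩)⟩⟩

end Summit.MatrixMultiplication.MatrixMultiplication.Theorems.HyperoctahedralThreshold
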